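/-
Copyright: the b2b-balaban cell (near-miss cell 7), T⁴-continuum fan-out, lineage t4-ne7b-p1 (node U5c COUNT member).
Released under the licence of the surrounding project.
-/
import Summits.QuantumFields.BalabanUV.T4Continuum.Support.ZoneDrivers
import Summits.QuantumFields.BalabanUV.T4Continuum.Support.CrowdingWeighted

/-!
# Zone crowd: the drivers of a chronological genealogy are dominated by the discounted weighted crowding

Summits-side support leaf of the T⁴-continuum cell (rung (B)+1 on a FINITE torus only; NOT infinite volume, NOT the
mass gap, NOT the Clay statement; NOT a proof of the spine estimate NE7b).  Lineage `t4-ne7b-p1`, node U5c, wall (GM),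
located item G-ne7bp1g18-2 parts (I)∕(II): the JOINT between the zone skeleton (`Support/ZoneSkeleton.lean`,
`Support/ZoneDrivers.lean`, generic) and the weighted crowding theorem (`Support/CrowdingWeighted.lean`, on the
dictionary's alphabet `PEv`).  [folklore]; nothing quoted, nothing printed asserted, no `[cite:]`.

WHAT.  With the dictionary weights `wtPEv e = d′ + 1` on kind-`0` events (births) and `1` otherwise, for a well-formed
genealogy `G : Gen PEv` whose births have kind `0` and whose mergers do not (both clauses of `Consistent`), and which is
CHRONOLOGICAL (`ZoneSkeleton.Chrono PEv.step G`: at every merger the partners' formation events are dated no later than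
the merger — displayed; not implied by the typed `Consistent`):
§1 the weighted count of the formation events at a step is `Crowding.wcnt` (`sum_wt_filter_eq_wcnt`);
§2 every sub-structure's driver at a step `t` dominating its formation events is at most the discounted weighted
crowding of the whole: `qZ wtPEv σ step S t ≤ Q (wcnt G) σ t` (`qZ_le_Q`);
§3 **`mergeProd_qZ_rpow_le`**: `mergeProd (q_Z^p) G ≤ ∏_{e ∈ merges G} Q(wcnt G, σ, step e)^p` (`p ≥ 0`, `σ ≥ 0`) —
so the last factor of `ZoneDrivers.card_admZSet_root_le_crowd` is exactly the product the binder `hlabZ` of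
`Support/PartnerMultiplicityZ.lean` carries, and the crowding theorem pays it inside the chain.
§4 the composite shape `zoneFactor_le_prod_Q`:
`(M₀ (C₀+1)^d)^{mergeCount G} · mergeProd (q_Z^d) G`
`  ≤ (M₀ (C₀+1)^d)^{#merges G} · ∏_{e ∈ merges G} Q(wcnt G, σ, step e)^d`.
(The skeleton's COUNT is over a finite event type; `PEv` is infinite — the instantiation counts over the finite
alphabet `dictE` in play and maps into `Gen PEv`; located for the (ID) owner, a transport lemma is routine.)

LOCATED, NOT DONE HERE.  The instantiation of `near`∕`NZ`∕`ext`∕`C₀`∕`M₀` and of the chronology for Bałaban's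
histories is the reading (ID) (G-ne7bp1g9-1); the per-record price (E2)∕(R1) (G-ne7bp1-1); the room of print's `a`.
NE7b: no date.

HONEST DEPENDENCY (cell): continuum YM on T⁴ ⇐ BetaPertH ∧ nine spine estimates (0/9 proved); BetaPertH ⇐ (D1) ∧ (D4)
∧ CAP+tail.  This file changes none of it.
-/

open Finset
open Literature.MathematicalPhysics.QuantumFieldTheory.Balaban1983to89
open T4PersistenceDictionary T4PartnerMultiplicity
open Summit.QuantumFields.BalabanUV.T4Continuum.PlacementSkeleton
open Summit.QuantumFields.BalabanUV.T4Continuum.PlacementBatch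
open Summit.QuantumFields.BalabanUV.T4Continuum.Crowding
open Summit.QuantumFields.BalabanUV.T4Continuum.ZoneSkeleton

namespace Summit.QuantumFields.BalabanUV.T4Continuum.ZoneCrowd

noncomputable section

/-! ## §1 The dictionary weights and the weighted count -/

/-- THE DICTIONARY WEIGHTS: a birth (kind `0`) of class `d′` weighs `d′ + 1`, every other event weighs `1` — the
per-event weight of `Crowding.wcnt` (a ZONE-EXTENT weight: every merger counts once).  Not to be confused with the
SIZE-COST weight `T4PrintedShapeBanking.wt` of the banking (which gives the connector class `dC` to a merger and `0`
to a renewal). [folklore] -/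
def wtPEv (e : PEv) : ℝ := if e.kind = 0 then (e.fat : ℝ) + 1 else 1

/-- `1 ≤ wtPEv e` [folklore] -/
theorem one_le_wtPEv (e : PEv) : 1 ≤ wtPEv e := by
  unfold wtPEv
  split_ifs
  · have : (0 : ℝ) ≤ e.fat := Nat.cast_nonneg _
    linarith
  · exact le_rfl

/-- `0 ≤ wtPEv e` [folklore] -/
theorem wtPEv_nonneg (e : PEv) : 0 ≤ wtPEv e := zero_le_one.trans (one_le_wtPEv e)

variable (W : PEv → ℕ)

/-- Under well-formedness the births and the mergers are disjoint event sets. [folklore] -/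
theorem disjoint_births_merges : ∀ {G : Gen PEv}, G.WF W → Disjoint (births G) (merges G)
  | Gen.born b j, _ => by simp [merges]
  | Gen.renew G e h, hW => by simpa [merges] using disjoint_births_merges (G := G) hW.1
  | Gen.merge X Y e, hW => by
      obtain ⟨heX, heY, hdM, hdB⟩ := merge_facts W hW
      have hXe : e ∉ births X := fun h => hW.2.2.1 (births_subset_events X h)
      have hYe : e ∉ births Y := fun h => hW.2.2.2.1 (births_subset_events Y h)
      have hXY : Disjoint (births X) (merges Y) :=
        hW.2.2.2.2.1.mono (births_subset_events X) (merges_subset_events Y)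
      have hYX : Disjoint (births Y) (merges X) :=
        (hW.2.2.2.2.1.mono (merges_subset_events X) (births_subset_events Y)).symm
      rw [births_merge, merges, disjoint_insert_right, mem_union, disjoint_union_left, disjoint_union_right,
        disjoint_union_right]
      exact ⟨fun h => h.elim hXe hYe, ⟨disjoint_births_merges hW.1, hXY⟩, ⟨hYX, disjoint_births_merges hW.2.1⟩⟩

/-- **THE WEIGHTED COUNT OF THE FORMATION EVENTS AT A STEP IS `wcnt`.**  For a well-formed genealogy with kind-`0`
births and non-kind-`0` mergers: `Σ_{w ∈ form G, step w = s} wtPEv w = wcnt G s`. [folklore] -/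
theorem sum_wt_filter_eq_wcnt {G : Gen PEv} (hW : G.WF W) (hk0 : ∀ b ∈ births G, b.kind = 0)
    (hk2 : ∀ m ∈ merges G, m.kind ≠ 0) (s : ℕ) :
    ∑ w ∈ (form G).filter (fun w => w.step = s), wtPEv w = (wcnt G s : ℝ) := by
  have hd : Disjoint ((births G).filter fun w => w.step = s) ((merges G).filter fun w => w.step = s) :=
    disjoint_filter_filter (disjoint_births_merges W hW)
  rw [form, filter_union, sum_union hd, wcnt, ← birthsAt_eq_filter hk0]
  have hb : ∑ w ∈ birthsAt (births G) s, wtPEv w = ∑ w ∈ birthsAt (births G) s, ((w.fat : ℝ) + 1) :=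
    sum_congr rfl fun w hw => by
      have := hk0 w (birthsAt_subset _ _ hw)
      simp [wtPEv, this]
  have hm : ∑ w ∈ (merges G).filter (fun w => w.step = s), wtPEv w = ((mergesAt G s).card : ℝ) := by
    rw [mergesAt, card_eq_sum_ones]
    push_cast
    refine sum_congr rfl fun w hw => ?_
    have := hk2 w (mem_filter.1 hw).1
    simp [wtPEv, this]
  rw [hb, hm]
  push_cast
  ring

/-! ## §2 A dated sub-structure's driver is at most the discounted weighted crowding of the whole -/

/-- **DRIVER ≤ CROWDING.**  If the formation events of `S` are formation events of `G` dated no later than `t`, then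
`qZ wtPEv σ step S t ≤ Q (wcnt G) σ t`. [folklore] -/
theorem qZ_le_Q {G S : Gen PEv} (hW : G.WF W) (hk0 : ∀ b ∈ births G, b.kind = 0)
    (hk2 : ∀ m ∈ merges G, m.kind ≠ 0) {σ : ℝ} (hσ : 0 ≤ σ) (hsub : form S ⊆ form G) {t : ℕ}
    (hdate : ∀ w ∈ form S, w.step ≤ t) :
    qZ wtPEv σ PEv.step S t ≤ Q (wcnt G) σ t := by
  set D := (form G).filter (fun w => w.step ≤ t) with hD
  have hsub' : form S ⊆ D := fun w hw => mem_filter.2 ⟨hsub hw, hdate w hw⟩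
  have hmaps : ∀ w ∈ D, w.step ∈ range (t + 1) := fun w hw =>
    mem_range.2 (Nat.lt_succ_of_le (mem_filter.1 hw).2)
  unfold qZ
  calc ∑ w ∈ form S, wtPEv w * σ ^ (2 * (t - PEv.step w))
      ≤ ∑ w ∈ D, wtPEv w * σ ^ (2 * (t - w.step)) :=
        sum_le_sum_of_subset_of_nonneg hsub' fun w _ _ => mul_nonneg (wtPEv_nonneg w) (pow_nonneg hσ _)
    _ = ∑ s ∈ range (t + 1), ∑ w ∈ D.filter (fun w => w.step = s), wtPEv w * σ ^ (2 * (t - w.step)) :=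
        (sum_fiberwise_of_maps_to hmaps _).symm
    _ = ∑ s ∈ range (t + 1), (∑ w ∈ (form G).filter (fun w => w.step = s), wtPEv w) * σ ^ (2 * (t - s)) := by
        refine sum_congr rfl fun s hs => ?_
        have hs' : s ≤ t := Nat.lt_succ_iff.1 (mem_range.1 hs)
        have hDs : D.filter (fun w => w.step = s) = (form G).filter (fun w => w.step = s) := by
          rw [hD, filter_filter]
          exact filter_congr fun w _ => ⟨fun h => h.2, fun h => ⟨h ▸ hs', h⟩⟩
        rw [hDs, sum_mul]
        exact sum_congr rfl fun w hw => by rw [(mem_filter.1 hw).2]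
    _ = Q (wcnt G) σ t := by
        unfold Q
        exact sum_congr rfl fun s _ => by rw [sum_wt_filter_eq_wcnt W hW hk0 hk2 s]

/-! ## §3 The structural product of the drivers against the product of crowdings -/

/-- births of a sub-structure of a well-formed merger are births of the merger (left) [folklore] -/
theorem form_left_subset (X Y : Gen PEv) (e : PEv) : form X ⊆ form (Gen.merge X Y e) := fun w hw => by
  simp only [form, births_merge, merges, mem_union, mem_insert] at hw ⊢
  tauto

/-- (right) [folklore] -/
theorem form_right_subset (X Y : Gen PEv) (e : PEv) : form Y ⊆ form (Gen.merge X Y e) := fun w hw => by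
  simp only [form, births_merge, merges, mem_union, mem_insert] at hw ⊢
  tauto

/-- the auxiliary induction over sub-structures `S` of a fixed `G` [folklore] -/
theorem mergeProd_qZ_rpow_le_aux {G : Gen PEv} (hW : G.WF W) (hk0 : ∀ b ∈ births G, b.kind = 0)
    (hk2 : ∀ m ∈ merges G, m.kind ≠ 0) {σ p : ℝ} (hσ : 0 ≤ σ) (hp : 0 ≤ p) :
    ∀ {S : Gen PEv}, S.WF W → Chrono PEv.step S → form S ⊆ form G →
      mergeProd (fun Z e => qZ wtPEv σ PEv.step Z e.step ^ p) S ≤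
        ∏ e ∈ merges S, Q (wcnt G) σ e.step ^ p
  | Gen.born b j, _, _, _ => by simp [mergeProd, merges]
  | Gen.renew S e h, hS, hc, hsub => by
      simpa [mergeProd, merges] using
        mergeProd_qZ_rpow_le_aux hW hk0 hk2 hσ hp (S := S) hS.1 hc (by simpa [form, merges] using hsub)
  | Gen.merge X Y e, hS, hc, hsub => by
      obtain ⟨heX, heY, hdM, -⟩ := merge_facts W hS
      obtain ⟨hcX, hcY, hdate⟩ := hc
      have hXY : e ∉ merges X ∪ merges Y := by simp [heX, heY]
      have ihX := mergeProd_qZ_rpow_le_aux hW hk0 hk2 hσ hp hS.1 hcX ((form_left_subset X Y e).trans hsub)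
      have ihY := mergeProd_qZ_rpow_le_aux hW hk0 hk2 hσ hp hS.2.1 hcY ((form_right_subset X Y e).trans hsub)
      -- the merger's own driver against the crowding at its step
      have hdate' : ∀ w ∈ form (Gen.merge X Y e), w.step ≤ e.step := by
        intro w hw
        simp only [form, births_merge, merges, mem_union, mem_insert] at hw
        rcases hw with (h | h) | rfl | (h | h)
        · exact hdate w (by simp [form, h])
        · exact hdate w (by simp [form, h])
        · exact le_rfl
        · exact hdate w (by simp [form, h])
        · exact hdate w (by simp [form, h])
      have hq : qZ wtPEv σ PEv.step (Gen.merge X Y e) e.step ≤ Q (wcnt G) σ e.step :=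
        qZ_le_Q W hW hk0 hk2 hσ hsub hdate'
      have hq0 : 0 ≤ qZ wtPEv σ PEv.step (Gen.merge X Y e) e.step :=
        sum_nonneg fun w _ => mul_nonneg (wtPEv_nonneg w) (pow_nonneg hσ _)
      have hqp : qZ wtPEv σ PEv.step (Gen.merge X Y e) e.step ^ p ≤ Q (wcnt G) σ e.step ^ p :=
        Real.rpow_le_rpow hq0 hq hp
      have hQ0 : ∀ e' : PEv, 0 ≤ Q (wcnt G) σ e'.step ^ p := fun e' =>
        Real.rpow_nonneg (sum_nonneg fun s _ => mul_nonneg (Nat.cast_nonneg _) (pow_nonneg hσ _)) p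
      have hP0 : ∀ s : Finset PEv, 0 ≤ ∏ e' ∈ s, Q (wcnt G) σ e'.step ^ p := fun s => prod_nonneg fun e' _ => hQ0 e'
      have hm0 : 0 ≤ mergeProd (fun Z e => qZ wtPEv σ PEv.step Z e.step ^ p) X :=
        mergeProd_nonneg _ (fun _ _ _ => Real.rpow_nonneg
          (sum_nonneg fun w _ => mul_nonneg (wtPEv_nonneg w) (pow_nonneg hσ _)) p) X
      have hm0Y : 0 ≤ mergeProd (fun Z e => qZ wtPEv σ PEv.step Z e.step ^ p) Y :=
        mergeProd_nonneg _ (fun _ _ _ => Real.rpow_nonneg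
          (sum_nonneg fun w _ => mul_nonneg (wtPEv_nonneg w) (pow_nonneg hσ _)) p) Y
      rw [mergeProd, merges, prod_insert hXY, prod_union hdM]
      calc mergeProd (fun Z e => qZ wtPEv σ PEv.step Z e.step ^ p) X *
            mergeProd (fun Z e => qZ wtPEv σ PEv.step Z e.step ^ p) Y *
            qZ wtPEv σ PEv.step (Gen.merge X Y e) e.step ^ p
          ≤ (∏ e' ∈ merges X, Q (wcnt G) σ e'.step ^ p) * (∏ e' ∈ merges Y, Q (wcnt G) σ e'.step ^ p) *
              Q (wcnt G) σ e.step ^ p :=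
            mul_le_mul (mul_le_mul ihX ihY hm0Y (hP0 _)) hqp (Real.rpow_nonneg hq0 p)
              (mul_nonneg (hP0 _) (hP0 _))
        _ = Q (wcnt G) σ e.step ^ p *
              ((∏ e' ∈ merges X, Q (wcnt G) σ e'.step ^ p) * ∏ e' ∈ merges Y, Q (wcnt G) σ e'.step ^ p) := by
            ring

/-- **THE DRIVERS AGAINST THE CROWDING.**  For a well-formed, chronological genealogy with kind-`0` births and
non-kind-`0` mergers, `p ≥ 0`, `σ ≥ 0`:
`mergeProd (q_Z^p) G ≤ ∏_{e ∈ merges G} Q(wcnt G, σ, step e)^p`, `q_Z = qZ wtPEv σ step Z (step e_Z)`. [folklore] -/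
theorem mergeProd_qZ_rpow_le {G : Gen PEv} (hW : G.WF W) (hk0 : ∀ b ∈ births G, b.kind = 0)
    (hk2 : ∀ m ∈ merges G, m.kind ≠ 0) (hchr : Chrono PEv.step G) {σ p : ℝ} (hσ : 0 ≤ σ) (hp : 0 ≤ p) :
    mergeProd (fun Z e => qZ wtPEv σ PEv.step Z e.step ^ p) G ≤ ∏ e ∈ merges G, Q (wcnt G) σ e.step ^ p :=
  mergeProd_qZ_rpow_le_aux W hW hk0 hk2 hσ hp hW hchr subset_rfl

/-! ## §4 The composite shape -/

/-- **COMPOSITE SHAPE (how the pieces fit).**  For a chronological well-formed genealogy on the dictionary's alphabet,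
the zone factor with the polynomial touch count is at most the binder `hlabZ`'s multiplicity:
`(M₀ (C₀+1)^d)^{mergeCount G} · mergeProd (q_Z^d) G`
`  ≤ (M₀ (C₀+1)^d)^{#merges G} · ∏_{e ∈ merges G} Q(wcnt G, σ, step e)^d`
(`mergeCount = #merges` under `Gen.WF`; natural powers as real powers). [folklore] -/
theorem zoneFactor_le_prod_Q {G : Gen PEv} (hW : G.WF W) (hk0 : ∀ b ∈ births G, b.kind = 0)
    (hk2 : ∀ m ∈ merges G, m.kind ≠ 0) (hchr : Chrono PEv.step G) {σ M₀ C₀ : ℝ} (hσ : 0 ≤ σ) (hM₀ : 0 ≤ M₀)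
    (hC : 0 ≤ C₀) (d : ℕ) :
    (M₀ * (C₀ + 1) ^ d) ^ mergeCount G * mergeProd (fun Z e => qZ wtPEv σ PEv.step Z e.step ^ d) G ≤
      (M₀ * (C₀ + 1) ^ d) ^ (merges G).card * ∏ e ∈ merges G, Q (wcnt G) σ e.step ^ (d : ℝ) := by
  rw [mergeCount_eq_card W hW]
  refine mul_le_mul_of_nonneg_left ?_ (by positivity)
  have h := mergeProd_qZ_rpow_le W hW hk0 hk2 hchr hσ (Nat.cast_nonneg d)
  have he : mergeProd (fun Z e => qZ wtPEv σ PEv.step Z e.step ^ d) G =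
      mergeProd (fun Z e => qZ wtPEv σ PEv.step Z e.step ^ (d : ℝ)) G := by
    congr 1
    funext Z e
    exact (Real.rpow_natCast _ d).symm
  rw [he]
  exact h

/-! ## §5 Sanity (decided ∕ closed instances; not used elsewhere) -/

namespace Sanity

/-- a birth of class `4` weighs `5`, a merger weighs `1` -/
theorem wt_examples : wtPEv (0, 0, 4) = 5 ∧ wtPEv (3, 2, 0) = 1 := by
  norm_num [wtPEv, PEv.kind, PEv.fat]

/-- the two-leaf merger dated after its leaves is chronological -/
theorem chrono_example :
    Chrono PEv.step (Gen.merge (Gen.born ((0, 0, 2) : PEv) 0) (Gen.born (1, 0, 0) 1) (3, 2, 0)) := by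
  refine ⟨trivial, trivial, ?_⟩
  decide

end Sanity

end

end Summit.QuantumFields.BalabanUV.T4Continuum.ZoneCrowd
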